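import Summits.BirchSwinnertonDyer.BirchSwinnertonDyer.Theorems.KimAtThreeD7uTamagawaIndexCorollaries
import Summits.BirchSwinnertonDyer.BirchSwinnertonDyer.Theorems.KimAtThreeD7uTamagawaSharpLocal
import HarnessLib

/-!
# The GLOBAL Tamagawa defect at finite level: `#Sel_{𝓕_can}(ℚ, E[p^{k+1}])` divides
# `#Sel_{𝓕_u}(ℚ, E[p^{k+1}]) · ∏_{p ∣ c_ℓ} #Φ_ℓ[p^{k+1}]`, hence `· p^{v_p(Tam(E/ℚ))}` (odd `p`)
# (cell `bsd-addord`, seat w2-tamdiv gen 8; route W2 `KimAtThreeKolyvagin`, items 19562 / 19679 / 19599, «TamDiv∞»)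

HONEST FRAMING: TOOL theorems (no definition, no named fact, no `sorry`); closes nothing by itself;
nothing is booked; BSD is not proved by any of this.  Part XXX of the seat's series.  Parts IV / VII
(`KimAtThreeD7uTamagawaFree{Structures,Product}`, `…TamagawaIndex{,Corollaries}`) say WHERE and BY HOW MUCH the two
Selmer structures on `E[p^k · p]` differ: [MR04] Remark A.5's unramified structure
`𝓕_u = blochKatoSelmerStructure p (tateTorsionDatum W p k) ⊤` (where Kato-type classes land, gen 2) and
Mazur–Rubin's canonical `𝓕_can = propagatedSelmerStructure W p k` (where the classical Selmer group lives)
agree at `w ∣ p` (relaxed), at `∞` (odd `p`), at every good `w` and at every bad `w ∤ p` with `p ∤ c_w`, and at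
a bad `w ∤ p` the index is `[𝓕_can(w) : 𝓕_u(w)] = #Φ_w[p^{k+1}] ∣ p^{v_p(c_w)}`.  This file draws the GLOBAL
consequence — the finite-level form of the «Tamagawa defect» of Selmer groups (Büyükboduk 2009 §2.1.2 /
Prop. 2.5: `[H¹_{𝓕_can}(ℚ,T) : H¹_{𝓕_u}(ℚ,T)]` divides the `p`-part of `∏ c_ℓ`; the factor `∏ c_ℓ` in every
Kato-type upper bound for `#Sel`):

* §1 (any number field `K`, any finite discrete module `M`) **`natCard_selmerGroup_dvd_mul_prod_relIndex`** —
  for Selmer structures `𝓕 ≤ 𝓖` that agree away from a finite set `S` of finite places,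
  `#H¹_𝓖(K, M) ∣ #H¹_𝓕(K, M) · ∏_{w ∈ S} [𝓖_w : 𝓕_w]` (the localisation `H¹_𝓖 → ⊕_{w∈S} 𝓖_w/𝓕_w` has
  kernel `H¹_𝓕`), with `selmerGroup_mono` (`H¹_𝓕 ≤ H¹_𝓖`).
* §2 (`E/ℚ`, `p` odd, every `k`) ★★ **`natCard_selmerGroup_propagated_dvd_mul_prod_torsionBy`** —
  `#Sel_{𝓕_can}(ℚ, E[p^k · p]) ∣ #Sel_{𝓕_u}(ℚ, E[p^k · p]) · ∏_{w ∈ S} #Φ_w[p^{k+1}]` for every finite set `S` of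
  places `w ∤ p` containing those with `p ∣ c_w`; ★★ **`…_dvd_mul_prod_pow_padicValNat`** (`· ∏_{w∈S} p^{v_p(c_w)}`);
  ★★★ **`natCard_selmerGroup_propagated_dvd_mul_pow_padicValNat_tamagawaProduct`** —
  `#Sel_{𝓕_can}(ℚ, E[p^k · p]) ∣ #Sel_{𝓕_u}(ℚ, E[p^k · p]) · p^{v_p(Tam(E/ℚ))}` (`Tam = ∏_ℓ c_ℓ`, tree
  `tamagawaProduct`); and `selmerGroup_blochKato_le_propagated` (`Sel_{𝓕_u} ≤ Sel_{𝓕_can}`).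

References: K. Büyükboduk, JNT 129 (2009) §2.1.2, Prop. 2.5, Remark 2; B. Mazur, K. Rubin, Mem. AMS 799 (2004)
Def. 2.1.1, Prop. 6.2.6, App. A Remark A.5; K. Rubin, *Euler Systems* (2000) Lemma 1.3.5, Thm. 2.2.2;
J. S. Milne, *ADT* I §6.
-/

noncomputable section

-- the cell's Theorems namespace `Summit.BirchSwinnertonDyer.BirchSwinnertonDyer.…` repeats the summit name by design (D-0017)
set_option linter.dupNamespace false

open CategoryTheory Function Field IsDedekindDomain NumberField
open scoped NumberField Classical
open Literature.NumberTheory.GaloisRepresentations Literature.NumberTheory.EllipticCurves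
open Literature.NumberTheory.GaloisRepresentations.DiscreteGaloisModule
open WeierstrassCurve
open Summit.BirchSwinnertonDyer.Rank1Residual.GaloisImage
open Summit.BirchSwinnertonDyer.BirchSwinnertonDyer.Theorems.KimAtThreeD7uBlochKatoCondition
open Summit.BirchSwinnertonDyer.BirchSwinnertonDyer.Theorems.KimAtThreeD7uKolyvaginPairBlochKato
open Summit.BirchSwinnertonDyer.BirchSwinnertonDyer.Theorems.KimAtThreeD7uTamagawaFreeStructures

namespace Summit.BirchSwinnertonDyer.BirchSwinnertonDyer.Theorems.KimAtThreeD7uTamagawaSelmerDefect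

universe u

/-! ### §1 Selmer structures that differ at finitely many places: `#H¹_𝓖 ∣ #H¹_𝓕 · ∏ [𝓖_w : 𝓕_w]` -/

section Abstract

variable {K : Type u} [Field K] [NumberField K]
variable {M : Type u} [AddCommGroup M] [TopologicalSpace M] [DiscreteTopology M]
variable {ρ : DiscreteGaloisModule K M}

/-- **Monotonicity of Selmer groups**: `𝓕 ≤ 𝓖` placewise implies `H¹_𝓕(K, M) ≤ H¹_𝓖(K, M)`.
[cite: MazurRubin2004, Def. 2.1.1] -/
theorem selmerGroup_mono {𝓕 𝓖 : SelmerStructure ρ} (hle : ∀ v, 𝓕 v ≤ 𝓖 v) :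
    𝓕.selmerGroup ≤ 𝓖.selmerGroup := fun x hx =>
  (SelmerStructure.mem_selmerGroup_iff 𝓖 x).mpr fun v => hle v ((SelmerStructure.mem_selmerGroup_iff 𝓕 x).mp hx v)

/-- **`#H¹_𝓖(K, M) ∣ #H¹_𝓕(K, M) · ∏_{w ∈ S} [𝓖_w : 𝓕_w]`** for Selmer structures `𝓕 ≤ 𝓖` on a discrete
Galois module over a number field which AGREE at every place not of the form `w ∈ S` (`S` a finite set of
finite places): the localisation `H¹_𝓖 → ∏_{w ∈ S} 𝓖_w/𝓕_w` has kernel exactly `H¹_𝓕`, and its image is a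
subgroup of a group of order `∏ [𝓖_w : 𝓕_w]` (Lagrange).  (`Nat.card` conventions: both sides are `0` when
the groups are infinite.) [cite: MazurRubin2004, Def. 2.1.1] [cite: MilneADT2006, I §6] -/
theorem natCard_selmerGroup_dvd_mul_prod_relIndex (𝓕 𝓖 : SelmerStructure ρ)
    (S : Finset (HeightOneSpectrum (𝓞 K))) (hle : ∀ v, 𝓕 v ≤ 𝓖 v)
    (heq : ∀ v : Place K, (∀ w ∈ S, v ≠ Sum.inr w) → 𝓕 v = 𝓖 v) :
    Nat.card 𝓖.selmerGroup ∣
      Nat.card 𝓕.selmerGroup * ∏ w ∈ S, (𝓕 (Sum.inr w)).relIndex (𝓖 (Sum.inr w)) := by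
  classical
  -- the target: `∏_{w ∈ S} (𝓖_w / 𝓕_w)`, realised inside `∏_{w ∈ S} H¹(K_w, M)/𝓕_w`
  let T : ↥S → Type u := fun w =>
    ↥((𝓖 (Sum.inr w.1)).map (QuotientAddGroup.mk' (𝓕 (Sum.inr w.1))))
  -- the components `x ↦ loc_w x mod 𝓕_w`
  let ψ : ∀ w : ↥S, 𝓖.selmerGroup →+ T w := fun w =>
    ((QuotientAddGroup.mk' (𝓕 (Sum.inr w.1))).comp
      ((galoisCohomology.localization ρ (Sum.inr w.1) 1).comp 𝓖.selmerGroup.subtype)).codRestrict _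
      fun x => AddSubgroup.mem_map_of_mem _
        ((SelmerStructure.mem_selmerGroup_iff 𝓖 (x : galoisCohomology ρ 1)).mp x.2 (Sum.inr w.1))
  have hψ : ∀ (w : ↥S) (x : 𝓖.selmerGroup), ((ψ w x : T w) : _ ⧸ 𝓕 (Sum.inr w.1)) =
      QuotientAddGroup.mk' (𝓕 (Sum.inr w.1))
        (galoisCohomology.localization ρ (Sum.inr w.1) 1 (x : galoisCohomology ρ 1)) := fun _ _ => rfl
  let Ψ : 𝓖.selmerGroup →+ (∀ w : ↥S, T w) :=
    { toFun := fun x w => ψ w x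
      map_zero' := funext fun w => map_zero (ψ w)
      map_add' := fun x y => funext fun w => map_add (ψ w) x y }
  -- kernel = `H¹_𝓕`
  have hsub : 𝓕.selmerGroup ≤ 𝓖.selmerGroup := selmerGroup_mono hle
  have hker : Ψ.ker = 𝓕.selmerGroup.addSubgroupOf 𝓖.selmerGroup := by
    ext x
    rw [AddMonoidHom.mem_ker, AddSubgroup.mem_addSubgroupOf, SelmerStructure.mem_selmerGroup_iff]
    constructor
    · intro h v
      by_cases hv : ∃ w ∈ S, v = Sum.inr w
      · obtain ⟨w, hwS, rfl⟩ := hv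
        have hw : Ψ x ⟨w, hwS⟩ = 0 := by rw [h]; rfl
        have hw' : ((ψ ⟨w, hwS⟩ x : T ⟨w, hwS⟩) : _ ⧸ 𝓕 (Sum.inr w)) = 0 := by
          rw [show ψ ⟨w, hwS⟩ x = Ψ x ⟨w, hwS⟩ from rfl, hw]; rfl
        rw [hψ, QuotientAddGroup.mk'_apply, QuotientAddGroup.eq_zero_iff] at hw'
        exact hw'
      · rw [heq v fun w hw hvw => hv ⟨w, hw, hvw⟩]
        exact (SelmerStructure.mem_selmerGroup_iff 𝓖 (x : galoisCohomology ρ 1)).mp x.2 v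
    · intro h
      funext w
      apply Subtype.ext
      show ((ψ w x : T w) : _ ⧸ 𝓕 (Sum.inr w.1)) = ((0 : T w) : _ ⧸ 𝓕 (Sum.inr w.1))
      rw [hψ, QuotientAddGroup.mk'_apply, ZeroMemClass.coe_zero, QuotientAddGroup.eq_zero_iff]
      exact h (Sum.inr w.1)
  -- counting
  have hcardker : Nat.card Ψ.ker = Nat.card 𝓕.selmerGroup := by
    rw [hker]
    exact Nat.card_congr (AddSubgroup.addSubgroupOfEquivOfLe hsub).toEquiv
  have hmul : Nat.card 𝓖.selmerGroup = Nat.card 𝓕.selmerGroup * Nat.card Ψ.range := by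
    rw [← hcardker, ← AddSubgroup.index_ker Ψ, AddSubgroup.card_mul_index]
  have hT : Nat.card (∀ w : ↥S, T w) = ∏ w ∈ S, (𝓕 (Sum.inr w)).relIndex (𝓖 (Sum.inr w)) := by
    rw [Nat.card_pi, Finset.prod_coe_sort_eq_attach, ← Finset.prod_attach S]
    refine Finset.prod_congr rfl fun w _ => ?_
    rw [← AddSubgroup.relIndex_ker, QuotientAddGroup.ker_mk']
  rw [hmul, ← hT]
  exact mul_dvd_mul_left _ (AddSubgroup.card_addSubgroup_dvd_card Ψ.range)

end Abstract

/-! ### §2 `E/ℚ`, odd `p`: `#Sel_{𝓕_can}(ℚ, E[p^k · p]) ∣ #Sel_{𝓕_u}(ℚ, E[p^k · p]) · p^{v_p(Tam(E/ℚ))}` -/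

section Rational

variable (W : WeierstrassCurve ℚ) [W.IsElliptic] (p : ℕ) [hp : Fact p.Prime] (k : ℕ)

/-- **`[𝓕_can(w) : 𝓕_u(w)] = #Φ_w[p^{k+1}]`** at a finite `w ∤ p` (part VII
`natCard_propagatedSelmerStructure_inr_eq_mul`, as a relative index). [cite: Rubin2000, Lemma 1.3.5]
[cite: MazurRubin2004, Prop. 6.2.6 (p. 75) and App. A Remark A.5 (p. 81)] -/
theorem relIndex_blochKatoSelmerStructure_propagatedSelmerStructure_eq_natCard_torsionBy
    (w : HeightOneSpectrum (𝓞 ℚ)) (L : (tateTorsionDatum W p k).LocalConditionsAbove p)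
    (hw : ((p : ℕ) : 𝓞 ℚ) ∉ w.asIdeal) :
    (blochKatoSelmerStructure p (tateTorsionDatum W p k) L (Sum.inr w)).relIndex
        (propagatedSelmerStructure W p k (Sum.inr w)) =
      Nat.card (AddSubgroup.torsionBy
        (((W.localMinimalIntegralModel w).baseChange (w.adicCompletion ℚ)).toAffine.Point ⧸
          (W.localMinimalIntegralModel w).nonsingularReductionSubgroup
            (integers_valuationRing_valuation (w.adicCompletionIntegers ℚ) (w.adicCompletion ℚ)))
        (p ^ (k + 1) : ℕ)) := by
  have hcard := KimAtThreeD7uTamagawaIndex.natCard_propagatedSelmerStructure_inr_eq_mul W p k w hw L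
  have hmul := AddSubgroup.relIndex_mul_relIndex _ _ _ bot_le
    (blochKatoSelmerStructure_inr_le_propagatedSelmerStructure W p k w L hw)
  rw [AddSubgroup.relIndex_bot_left, AddSubgroup.relIndex_bot_left] at hmul
  have hfinC := KimAtThreeD7uTamagawaIndex.finite_propagatedSelmerStructure_inr W p k w hw
  haveI hfin : Finite (blochKatoSelmerStructure p (tateTorsionDatum W p k) L (Sum.inr w)) :=
    @Finite.of_injective _ _ hfinC
      (AddSubgroup.inclusion (blochKatoSelmerStructure_inr_le_propagatedSelmerStructure W p k w L hw))
      (AddSubgroup.inclusion_injective _)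
  haveI : Nonempty (blochKatoSelmerStructure p (tateTorsionDatum W p k) L (Sum.inr w)) := ⟨0⟩
  exact Nat.eq_of_mul_eq_mul_left (Nat.card_pos (α := blochKatoSelmerStructure p (tateTorsionDatum W p k) L
    (Sum.inr w))) (hmul.trans hcard)

/-- **`Sel_{𝓕_u}(ℚ, E[p^k · p]) ≤ Sel_{𝓕_can}(ℚ, E[p^k · p])`** for odd `p` ([MR04] Remark A.5's unramified
structure, relaxed above `p`, lies under the canonical structure at every place).
[cite: MazurRubin2004, App. A Remark A.5 (p. 81)] -/
theorem selmerGroup_blochKato_le_propagated (hp2 : p ≠ 2) :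
    (blochKatoSelmerStructure p (tateTorsionDatum W p k) (fun _ _ => ⊤)).selmerGroup ≤
      (propagatedSelmerStructure W p k).selmerGroup := by
  refine selmerGroup_mono fun v => ?_
  cases v with
  | inl v => exact (blochKatoSelmerStructure_inl_eq_propagatedSelmerStructure_of_odd W p k hp2 _ v).le
  | inr w =>
    by_cases hw : ((p : ℕ) : 𝓞 ℚ) ∈ w.asIdeal
    · exact (blochKatoSelmerStructure_relaxed_inr_eq_propagatedSelmerStructure W p k w hw).le
    · exact blochKatoSelmerStructure_inr_le_propagatedSelmerStructure W p k w _ hw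

/-- **The global Tamagawa defect at finite level, component-group form**: for `W/ℚ` elliptic, an ODD
prime `p`, a depth `k`, and any finite set `S` of finite places `w ∤ p` containing every `w ∤ p` with
`p ∣ c_w`:  `#Sel_{𝓕_can}(ℚ, E[p^k · p]) ∣ #Sel_{𝓕_u}(ℚ, E[p^k · p]) · ∏_{w ∈ S} #Φ_w[p^{k+1}]`
(`Φ_w = X(ℚ_w)/X₀(ℚ_w)` the component group of the minimal model, `#Φ_w = c_w`).  The two structures agree
off `S` (parts IV/VII: `w ∣ p` relaxed, `∞` for odd `p`, `p ∤ c_w`), so §1 applies with the indices of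
part VII. [cite: Buyukboduk2009TamagawaDefect, §2.1.2 Remark 2 and Prop. 2.5]
[cite: MazurRubin2004, Prop. 6.2.6 (p. 75) and App. A Remark A.5 (p. 81)] -/
theorem natCard_selmerGroup_propagated_dvd_mul_prod_torsionBy (hp2 : p ≠ 2)
    (S : Finset (HeightOneSpectrum (𝓞 ℚ))) (hSp : ∀ w ∈ S, ((p : ℕ) : 𝓞 ℚ) ∉ w.asIdeal)
    (hS : ∀ w : HeightOneSpectrum (𝓞 ℚ), ((p : ℕ) : 𝓞 ℚ) ∉ w.asIdeal →
      p ∣ (W.baseChange (w.adicCompletion ℚ)).localTamagawaNumber (w.adicCompletionIntegers ℚ) → w ∈ S) :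
    Nat.card (propagatedSelmerStructure W p k).selmerGroup ∣
      Nat.card (blochKatoSelmerStructure p (tateTorsionDatum W p k) (fun _ _ => ⊤)).selmerGroup *
        ∏ w ∈ S, Nat.card (AddSubgroup.torsionBy
          (((W.localMinimalIntegralModel w).baseChange (w.adicCompletion ℚ)).toAffine.Point ⧸
            (W.localMinimalIntegralModel w).nonsingularReductionSubgroup
              (integers_valuationRing_valuation (w.adicCompletionIntegers ℚ) (w.adicCompletion ℚ)))
          (p ^ (k + 1) : ℕ)) := by
  have h := natCard_selmerGroup_dvd_mul_prod_relIndex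
    (blochKatoSelmerStructure p (tateTorsionDatum W p k) (fun _ _ => ⊤)) (propagatedSelmerStructure W p k) S
    (fun v => ?_) (fun v hv => ?_)
  · refine h.trans (dvd_of_eq ?_)
    congr 1
    exact Finset.prod_congr rfl fun w hw =>
      relIndex_blochKatoSelmerStructure_propagatedSelmerStructure_eq_natCard_torsionBy W p k w _ (hSp w hw)
  · -- `𝓕_u ≤ 𝓕_can` placewise
    cases v with
    | inl v => exact (blochKatoSelmerStructure_inl_eq_propagatedSelmerStructure_of_odd W p k hp2 _ v).le
    | inr w =>
      by_cases hw : ((p : ℕ) : 𝓞 ℚ) ∈ w.asIdeal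
      · exact (blochKatoSelmerStructure_relaxed_inr_eq_propagatedSelmerStructure W p k w hw).le
      · exact blochKatoSelmerStructure_inr_le_propagatedSelmerStructure W p k w _ hw
  · -- equality off `S`
    cases v with
    | inl v => exact blochKatoSelmerStructure_inl_eq_propagatedSelmerStructure_of_odd W p k hp2 _ v
    | inr w =>
      by_cases hw : ((p : ℕ) : 𝓞 ℚ) ∈ w.asIdeal
      · exact blochKatoSelmerStructure_relaxed_inr_eq_propagatedSelmerStructure W p k w hw
      · have hc : ¬ p ∣ (W.baseChange (w.adicCompletion ℚ)).localTamagawaNumber (w.adicCompletionIntegers ℚ) :=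
          fun hc => hv w (hS w hw hc) rfl
        exact blochKatoSelmerStructure_inr_eq_propagatedSelmerStructure_of_not_dvd_localTamagawaNumber
          W p k w _ hw hc

/-- **The global Tamagawa defect at finite level, valuation form**: with `S` as above,
`#Sel_{𝓕_can}(ℚ, E[p^k · p]) ∣ #Sel_{𝓕_u}(ℚ, E[p^k · p]) · ∏_{w ∈ S} p^{v_p(c_w)}` (`#Φ_w[p^{k+1}] ∣ p^{v_p(c_w)}`,
part XVI `natCard_torsionBy_componentQuotient_dvd_pow_padicValNat`).
[cite: Buyukboduk2009TamagawaDefect, §2.1.2 Remark 2 and Prop. 2.5] [cite: MazurRubin2004, Prop. 6.2.6 (p. 75)] -/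
theorem natCard_selmerGroup_propagated_dvd_mul_prod_pow_padicValNat (hp2 : p ≠ 2)
    (S : Finset (HeightOneSpectrum (𝓞 ℚ))) (hSp : ∀ w ∈ S, ((p : ℕ) : 𝓞 ℚ) ∉ w.asIdeal)
    (hS : ∀ w : HeightOneSpectrum (𝓞 ℚ), ((p : ℕ) : 𝓞 ℚ) ∉ w.asIdeal →
      p ∣ (W.baseChange (w.adicCompletion ℚ)).localTamagawaNumber (w.adicCompletionIntegers ℚ) → w ∈ S) :
    Nat.card (propagatedSelmerStructure W p k).selmerGroup ∣
      Nat.card (blochKatoSelmerStructure p (tateTorsionDatum W p k) (fun _ _ => ⊤)).selmerGroup *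
        ∏ w ∈ S, p ^ padicValNat p
          ((W.baseChange (w.adicCompletion ℚ)).localTamagawaNumber (w.adicCompletionIntegers ℚ)) := by
  refine (natCard_selmerGroup_propagated_dvd_mul_prod_torsionBy W p k hp2 S hSp hS).trans
    (mul_dvd_mul_left _ (Finset.prod_dvd_prod_of_dvd _ _ fun w _ => ?_))
  exact KimAtThreeD7uTamagawaSharp.natCard_torsionBy_componentQuotient_dvd_pow_padicValNat W p k w

/-- `∏_{i ∈ s} p^{v_p(f i)} = p^{v_p(∏_{i ∈ s} f i)}` for non-zero naturals `f i`. [folklore] -/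
theorem prod_pow_padicValNat_eq_pow_padicValNat_prod {ι : Type*} (s : Finset ι) (f : ι → ℕ)
    (hf : ∀ i ∈ s, f i ≠ 0) :
    ∏ i ∈ s, p ^ padicValNat p (f i) = p ^ padicValNat p (∏ i ∈ s, f i) := by
  classical
  induction s using Finset.induction_on with
  | empty => simp
  | insert a s ha ih =>
    have hfs : ∀ i ∈ s, f i ≠ 0 := fun i hi => hf i (Finset.mem_insert_of_mem hi)
    rw [Finset.prod_insert ha, Finset.prod_insert ha, ih hfs,
      padicValNat.mul (hf a (Finset.mem_insert_self a s)) (Finset.prod_ne_zero_iff.mpr hfs), pow_add]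

/-- `∏_{w ∈ S} p^{v_p(c_w)} ∣ p^{v_p(Tam(E/ℚ))}` for every finite set `S` of finite places: the sub-product
`∏_{w ∈ S} c_w` divides the Tamagawa product `∏ᶠ_w c_w` (all `c_w ≥ 1`, finitely many `≠ 1`).
[cite: SilvermanAEC2009, Cor. VII.6.2] -/
theorem prod_pow_padicValNat_localTamagawaNumber_dvd (S : Finset (HeightOneSpectrum (𝓞 ℚ))) :
    ∏ w ∈ S, p ^ padicValNat p ((W.baseChange (w.adicCompletion ℚ)).localTamagawaNumber (w.adicCompletionIntegers ℚ)) ∣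
      p ^ padicValNat p W.tamagawaProduct := by
  classical
  set c : HeightOneSpectrum (𝓞 ℚ) → ℕ := fun w =>
    (W.baseChange (w.adicCompletion ℚ)).localTamagawaNumber (w.adicCompletionIntegers ℚ) with hc
  have hc0 : ∀ w, c w ≠ 0 := fun w => W.localTamagawaNumber_baseChange_ne_zero w
  have hfin : (Function.mulSupport c).Finite := W.mulSupport_localTamagawaNumber_finite_holds
  have htam : W.tamagawaProduct = ∏ w ∈ hfin.toFinset, c w :=
    finprod_eq_prod_of_mulSupport_subset c (by simp [Set.Finite.coe_toFinset])
  have htam0 : W.tamagawaProduct ≠ 0 := by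
    rw [htam]; exact Finset.prod_ne_zero_iff.mpr fun w _ => hc0 w
  -- `∏_{w ∈ S} c_w ∣ Tam`
  have hdvd : ∏ w ∈ S, c w ∣ W.tamagawaProduct := by
    rw [htam, ← Finset.prod_filter_mul_prod_filter_not S (fun w => w ∈ hfin.toFinset)]
    have h1 : ∏ w ∈ S.filter (fun w => w ∉ hfin.toFinset), c w = 1 :=
      Finset.prod_eq_one fun w hw => by
        have hw' := (Finset.mem_filter.mp hw).2
        rwa [Set.Finite.mem_toFinset, Function.mem_mulSupport, not_not] at hw'
    rw [h1, mul_one]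
    exact Finset.prod_dvd_prod_of_subset _ _ _ fun w hw => (Finset.mem_filter.mp hw).2
  rw [prod_pow_padicValNat_eq_pow_padicValNat_prod p S c fun w _ => hc0 w]
  refine pow_dvd_pow p ((padicValNat_dvd_iff_le htam0).mp ?_)
  exact pow_padicValNat_dvd.trans hdvd

/-- **The global Tamagawa defect at finite level, Tamagawa-PRODUCT form** (no auxiliary set): for `W/ℚ`
elliptic, an ODD prime `p` and every depth `k`,
  `#Sel_{𝓕_can}(ℚ, E[p^k · p]) ∣ #Sel_{𝓕_u}(ℚ, E[p^k · p]) · p^{v_p(Tam(E/ℚ))}`,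
`Tam(E/ℚ) = ∏_ℓ c_ℓ` the Tamagawa product of the minimal models (tree `tamagawaProduct`): the classical
Selmer structure exceeds [MR04] Remark A.5's unramified one — the one Kato-type Kolyvagin systems control —
by at most the `p`-part of the Tamagawa product.  (Büyükboduk 2009 §2.1.2 / Prop. 2.5 for `T_pE` at finite
level; the source of the factor `∏ c_ℓ` in Euler-system upper bounds for `#Sel`.)
[cite: Buyukboduk2009TamagawaDefect, §2.1.2 Remark 2 and Prop. 2.5] [cite: Rubin2000, Lemma 1.3.5 and Thm. 2.2.2]
[cite: MazurRubin2004, Prop. 6.2.6 (p. 75) and App. A Remark A.5 (p. 81)] -/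
theorem natCard_selmerGroup_propagated_dvd_mul_pow_padicValNat_tamagawaProduct (hp2 : p ≠ 2) :
    Nat.card (propagatedSelmerStructure W p k).selmerGroup ∣
      Nat.card (blochKatoSelmerStructure p (tateTorsionDatum W p k) (fun _ _ => ⊤)).selmerGroup *
        p ^ padicValNat p W.tamagawaProduct := by
  classical
  have hfin : (Function.mulSupport fun w : HeightOneSpectrum (𝓞 ℚ) =>
      (W.baseChange (w.adicCompletion ℚ)).localTamagawaNumber (w.adicCompletionIntegers ℚ)).Finite :=
    W.mulSupport_localTamagawaNumber_finite_holds
  -- `S` = the places `w ∤ p` with `c_w ≠ 1`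
  let S : Finset (HeightOneSpectrum (𝓞 ℚ)) := hfin.toFinset.filter fun w => ((p : ℕ) : 𝓞 ℚ) ∉ w.asIdeal
  have hSp : ∀ w ∈ S, ((p : ℕ) : 𝓞 ℚ) ∉ w.asIdeal := fun w hw => (Finset.mem_filter.mp hw).2
  have hS : ∀ w : HeightOneSpectrum (𝓞 ℚ), ((p : ℕ) : 𝓞 ℚ) ∉ w.asIdeal →
      p ∣ (W.baseChange (w.adicCompletion ℚ)).localTamagawaNumber (w.adicCompletionIntegers ℚ) → w ∈ S := by
    intro w hw hc
    refine Finset.mem_filter.mpr ⟨(Set.Finite.mem_toFinset hfin).mpr ?_, hw⟩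
    rw [Function.mem_mulSupport]
    intro h1
    rw [h1] at hc
    exact hp.out.one_lt.ne' (Nat.dvd_one.mp hc)
  exact (natCard_selmerGroup_propagated_dvd_mul_prod_pow_padicValNat W p k hp2 S hSp hS).trans
    (mul_dvd_mul_left _ (prod_pow_padicValNat_localTamagawaNumber_dvd W p S))

end Rational

end Summit.BirchSwinnertonDyer.BirchSwinnertonDyer.Theorems.KimAtThreeD7uTamagawaSelmerDefect

end
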